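import Literature.MathematicalPhysics.StatisticalMechanics.PeriodicConfigurationSums
import Summits.AtomisticToContinuum.Crystallization.Theses.ExcessDecayLiouville

/-!
# Disproof workfile for crux `PhononStability` (stmt-AtomisticToContinuum-9333)

Standing adversary: refuter-cdisprove-stmt-AtomisticToContinuum-9333-0 (route ExcessDecayLiouville,
crux rank 4: uniform harmonic stability of Lennard-Jones over the admissible affine-hcp window,
`κ·Σ_{|p−q|≤11/10}‖u_p−u_q‖² ≤ ½Σ_{p≠q} Hess(p−q)(u_p−u_q)`).

FINDINGS (index; details in the part docstrings below — parts I–IV are byte-identical to the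
files proposed under `Theorems/PhononStability/Negative/{Mirror,WithoutAdm,InnerSites,WithoutInner}.lean`,
part V is workfile-only):
* Part I (Mirror) — named copies of the crux's `let`s, `phononStability_iff` (`Iff.rfl`) and the
  window-predicate form `PhononStabilityOn W` (crux ⟺ `W = Adm ∧ Inner`): the statement elaborates
  and reads back as intended (tsums honest for finitely supported `u`; `deriv`/`deriv∘deriv` of
  `lennardJones` are the true `V′, V″` on `r > 0`; sublattices disjoint; NN shell `[0.92,1.02]`
  below the cutoff `11/10` below the second shell `≥ 1.31`).  NO typing junk found.
* Part II — `Adm` is load-bearing: `phononStability_false_without_Adm : ¬ PhononStabilityOn Inner₀`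
  (A = 0, two-point site set, transverse pre-stress `40·V′(1/40) < 0`).  PROVED (std axioms).
* Parts III–IV — `Inner` is load-bearing: `phononStability_false_without_Inner :
  ¬ PhononStabilityOn (fun _ A => Adm₀ A)` (A₀ = 0.97·id, second sublattice at `δe₃`,
  `V′(δ)/δ → −∞` beats the `δ`-free far-field bound `M` from ZLattice summability).  PROVED.
* Part V (numerics, comments + one sorried near-miss) — the crux itself RESISTS: adversarial
  search over the full 9-dim window finds `min λ_gen(D(k),N(k)) ≈ 0.105 > 0` (relaxed cell 0.466),
  attained at an extreme point (principal stretches (0.945,0.945,0.995), tilted axes, |d| = 1/40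
  along c) in the long-wave acoustic regime; the window is TIGHT: scaled by 1.25 it is unstable.
-/

/-!
# `PhononStability` (stmt-AtomisticToContinuum-9333), negative side I: mirror, mutated statements, force-constant bounds

Route `ExcessDecayLiouville`, crux `PhononStability` (rank 4): uniform harmonic (acoustic +
optical) stability of Lennard-Jones over the admissible affine-hcp window,
`κ·Σ_{|p−q|≤11/10}‖u_p−u_q‖² ≤ ½Σ_{p≠q} Hess(p−q)(u_p−u_q)`.  This file (part I of the
load-bearing analysis by the standing disprover) names the crux's `let`-bound objects (`Λ₀`,
`Adm₀`, `Inner₀`, `Sites₀`, `Hess₀`, `nnForm`, `hessForm`), records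
`phononStability_iff : PhononStability ↔ …` (by `Iff.rfl`; the form provers `rw` into), states the
window-predicate form `PhononStabilityOn W` (the crux = `W = Adm ∧ Inner`, `phononStability_iff_on`;
the MUTATED statements of parts II/IV are `W = Inner₀` alone, `W = Adm₀` alone), and proves the
elementary facts every user of the crux needs: `V′(r) = −r⁻¹³ + r⁻⁷` and `V″(r) = 13r⁻¹⁴ − 7r⁻⁸`
as `deriv`s of `lennardJones` on `r ≠ 0`, the bound `|wᵀK(e)w| ≤ (|V″(|e|)| + |V′(|e|)|/|e|)‖w‖²`
(`≤ 904‖e‖⁻⁸` once `‖e‖ ≥ 1/2`, `‖w‖ = 1`), evenness of `K`, two-point `tsum`s, `nnForm ≥ 0`.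
All `[folklore]`.
-/

noncomputable section

namespace Summit.AtomisticToContinuum.Crystallization.Cruxes.PhononStability.Disproof

open scoped BigOperators Topology Classical InnerProductSpace
open Filter Set Function
open Literature.MathematicalPhysics.StatisticalMechanics
open Summit.AtomisticToContinuum.Crystallization.Theses.ExcessDecayLiouville

local notation "E3" => EuclideanSpace ℝ (Fin 3)

/-! ## §0 Mirror of the crux's local definitions -/

/-- The hexagonal period lattice `Λ = ℤu + ℤv + ℤ·2√(2/3)e₃` of the unit hcp stacking
(verbatim the crux's `let Λ`). [folklore] -/
def Λ₀ : Set E3 :=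
  {z | ∃ i j k : ℤ, z = (i : ℝ) • triangularVec₁ 1 + (j : ℝ) • triangularVec₂ 1 +
    (k : ℝ) • layerNormal (2 * Real.sqrt (2 / 3))}

/-- Admissible cells: `‖A − 0.97·R‖ ≤ 1/40` for some linear isometry `R` (verbatim `let Adm`). [folklore] -/
def Adm₀ (A : E3 →L[ℝ] E3) : Prop :=
  ∃ R : E3 ≃ₗᵢ[ℝ] E3, ‖A - (97 / 100 : ℝ) • (R.toContinuousLinearEquiv : E3 →L[ℝ] E3)‖ ≤ 1 / 40

/-- hcp-like inner displacement (verbatim `let Inner`). [folklore] -/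
def Inner₀ (t : Fin 2 → E3) (A : E3 →L[ℝ] E3) : Prop :=
  ‖t 1 - t 0 - A (barlowOffset 1 + layerNormal (Real.sqrt (2 / 3)))‖ ≤ 1 / 40

/-- The site set `S = {t_m + A z}` (verbatim `let Sites`). [folklore] -/
def Sites₀ (t : Fin 2 → E3) (A : E3 →L[ℝ] E3) : Set E3 :=
  {p | ∃ m : Fin 2, ∃ z ∈ Λ₀, p = t m + A z}

/-- The LJ pair force-constant quadratic form `wᵀ K(e) w` (verbatim `let Hess`). [folklore] -/
def Hess₀ (e w : E3) : ℝ :=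
  deriv (deriv lennardJones) ‖e‖ * (inner ℝ e w / ‖e‖) ^ 2 +
    deriv lennardJones ‖e‖ / ‖e‖ * (‖w‖ ^ 2 - (inner ℝ e w / ‖e‖) ^ 2)

/-- Nearest-neighbour strain form (the crux's left-hand double sum). [folklore] -/
def nnForm (t : Fin 2 → E3) (A : E3 →L[ℝ] E3) (u : E3 → E3) : ℝ :=
  ∑' p : Sites₀ t A, ∑' q : Sites₀ t A,
    if dist (p : E3) q ≤ 11 / 10 then ‖u p - u q‖ ^ 2 else 0

/-- Second-variation double sum (the crux's right-hand double sum, before halving). [folklore] -/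
def hessForm (t : Fin 2 → E3) (A : E3 →L[ℝ] E3) (u : E3 → E3) : ℝ :=
  ∑' p : Sites₀ t A, ∑' q : Sites₀ t A,
    if (p : E3) ≠ q then Hess₀ ((p : E3) - q) (u p - u q) else 0

/-- The crux over the named mirror definitions (definitional unfolding only). [folklore] -/
theorem phononStability_iff :
    PhononStability ↔
      ∃ κ : ℝ, 0 < κ ∧ ∀ (t : Fin 2 → E3) (A : E3 →L[ℝ] E3), Adm₀ A → Inner₀ t A →
        ∀ u : E3 → E3, (Function.support u).Finite → Function.support u ⊆ Sites₀ t A →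
          κ * nnForm t A u ≤ hessForm t A u / 2 :=
  Iff.rfl

/-! ## Stability on a window predicate (the mutated statements) -/

/-- **Harmonic stability on a window predicate**: the crux's inequality with its two hypotheses
`Adm A`, `Inner t A` replaced by an arbitrary predicate `W t A` on the datum `(t, A)`.  The crux
is `PhononStabilityOn (fun t A => Adm₀ A ∧ Inner₀ t A)` (`phononStability_iff_on`); dropping a
hypothesis means enlarging `W` (parts II and IV refute `W = Inner₀` alone and `W = Adm₀` alone).
[folklore] -/
def PhononStabilityOn (W : (Fin 2 → E3) → (E3 →L[ℝ] E3) → Prop) : Prop :=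
  ∃ κ : ℝ, 0 < κ ∧ ∀ (t : Fin 2 → E3) (A : E3 →L[ℝ] E3), W t A →
    ∀ u : E3 → E3, (Function.support u).Finite → Function.support u ⊆ Sites₀ t A →
      κ * nnForm t A u ≤ hessForm t A u / 2

/-- The crux is stability on the admissible window `Adm A ∧ Inner t A`. [folklore] -/
theorem phononStability_iff_on :
    PhononStability ↔ PhononStabilityOn fun t A => Adm₀ A ∧ Inner₀ t A := by
  rw [phononStability_iff]
  unfold PhononStabilityOn
  constructor
  · rintro ⟨κ, hκ, h⟩
    exact ⟨κ, hκ, fun t A hW => h t A hW.1 hW.2⟩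
  · rintro ⟨κ, hκ, h⟩
    exact ⟨κ, hκ, fun t A hA hI => h t A ⟨hA, hI⟩⟩

/-- Stability on a window is monotone: it passes to smaller windows. [folklore] -/
theorem PhononStabilityOn.mono {W W' : (Fin 2 → E3) → (E3 →L[ℝ] E3) → Prop}
    (h : PhononStabilityOn W) (hle : ∀ t A, W' t A → W t A) : PhononStabilityOn W' := by
  unfold PhononStabilityOn at *
  obtain ⟨κ, hκ, h⟩ := h
  exact ⟨κ, hκ, fun t A hW' => h t A (hle t A hW')⟩

/-! ### Helper facts -/

/-- `V_LJ` is differentiable away from `0` with `V′(r) = -r⁻¹³ + r⁻⁷`. [folklore] -/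
theorem hasDerivAt_lennardJones {r : ℝ} (hr : r ≠ 0) :
    HasDerivAt lennardJones (-(r⁻¹) ^ 13 + (r⁻¹) ^ 7) r := by
  have h1 : HasDerivAt (fun y : ℝ => y⁻¹) (-(r ^ 2)⁻¹) r := hasDerivAt_inv hr
  have hfun : lennardJones = fun y : ℝ => (1 / 12 : ℝ) * (y⁻¹) ^ 12 - (1 / 6 : ℝ) * (y⁻¹) ^ 6 := by
    funext y; simp [lennardJones]
  rw [hfun]
  refine (((h1.pow 12).const_mul (1 / 12 : ℝ)).sub ((h1.pow 6).const_mul (1 / 6 : ℝ))).congr_deriv ?_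
  push_cast
  ring

/-- `V′(r) = -r⁻¹³ + r⁻⁷` for `r ≠ 0`, as a `deriv`. [folklore] -/
theorem deriv_lennardJones {r : ℝ} (hr : r ≠ 0) :
    deriv lennardJones r = -(r⁻¹) ^ 13 + (r⁻¹) ^ 7 :=
  (hasDerivAt_lennardJones hr).deriv

/-- A `tsum` over a two-element set. [folklore] -/
theorem tsum_pair {β : Type*} {a b : β} (hab : a ≠ b) (f : β → ℝ) :
    ∑' x : ({a, b} : Set β), f x = f a + f b := by
  have h : ({a, b} : Set β) = ((({a, b} : Finset β)) : Set β) := by simp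
  rw [h, Finset.tsum_subtype', Finset.sum_pair hab]

/-- A double `tsum` over a two-element set. [folklore] -/
theorem tsum_tsum_pair {β : Type*} {a b : β} (hab : a ≠ b) (F : β → β → ℝ) :
    ∑' p : ({a, b} : Set β), ∑' q : ({a, b} : Set β), F p q =
      F a a + F a b + (F b a + F b b) := by
  rw [tsum_pair hab (fun p => ∑' q : ({a, b} : Set β), F p q)]
  simp only [tsum_pair hab (F a), tsum_pair hab (F b)]

/-- `0 ∈ Λ`. [folklore] -/
theorem zero_mem_Λ₀ : (0 : E3) ∈ Λ₀ := ⟨0, 0, 0, by simp⟩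

/-- With the zero cell the site set collapses to the two sublattice origins. [folklore] -/
theorem sites₀_zero (t : Fin 2 → E3) : Sites₀ t 0 = {t 0, t 1} := by
  ext p
  simp only [Sites₀, _root_.zero_apply, add_zero, Set.mem_setOf_eq,
    Set.mem_insert_iff, Set.mem_singleton_iff]
  constructor
  · rintro ⟨m, z, -, rfl⟩
    fin_cases m <;> simp
  · rintro (rfl | rfl)
    · exact ⟨0, 0, zero_mem_Λ₀, rfl⟩
    · exact ⟨1, 0, zero_mem_Λ₀, rfl⟩

/-- On transverse displacements only the pre-stress term `V′(r)/r` of `K(e)` acts. [folklore] -/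
theorem Hess₀_of_inner_eq_zero {e w : E3} (h : inner ℝ e w = 0) :
    Hess₀ e w = deriv lennardJones ‖e‖ / ‖e‖ * ‖w‖ ^ 2 := by
  simp [Hess₀, h]

/-- `K(−e) = K(e)`: the form is even in the bond vector. [folklore] -/
theorem Hess₀_neg_left (e w : E3) : Hess₀ (-e) w = Hess₀ e w := by
  simp [Hess₀, norm_neg, inner_neg_left, neg_div]

/-- `wᵀK(e)w` is even in `w`. [folklore] -/
theorem Hess₀_neg_right (e w : E3) : Hess₀ e (-w) = Hess₀ e w := by
  simp [Hess₀, norm_neg, inner_neg_right, neg_div]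

/-- `0ᵀK(e)0 = 0`. [folklore] -/
@[simp] theorem Hess₀_zero_right (e : E3) : Hess₀ e 0 = 0 := by
  simp [Hess₀]

/-! ### The force-constant form: second derivative and a crude bound -/

/-- `V″(r) = 13 r⁻¹⁴ − 7 r⁻⁸` for `r ≠ 0`. [folklore] -/
theorem deriv_deriv_lennardJones {r : ℝ} (hr : r ≠ 0) :
    deriv (deriv lennardJones) r = 13 * (r⁻¹) ^ 14 - 7 * (r⁻¹) ^ 8 := by
  have hev : deriv lennardJones =ᶠ[𝓝 r] fun y => -(y⁻¹) ^ 13 + (y⁻¹) ^ 7 := by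
    filter_upwards [eventually_ne_nhds hr] with y hy using deriv_lennardJones hy
  rw [hev.deriv_eq]
  have h1 : HasDerivAt (fun y : ℝ => y⁻¹) (-(r ^ 2)⁻¹) r := hasDerivAt_inv hr
  have h := (h1.pow 13).neg.add (h1.pow 7)
  refine (h.deriv.trans ?_)
  push_cast
  ring

/-- Crude bound `|wᵀK(e)w| ≤ (|V″(|e|)| + |V′(|e|)|/|e|)·‖w‖²`. [folklore] -/
theorem abs_Hess₀_le (e w : E3) :
    |Hess₀ e w| ≤ (|deriv (deriv lennardJones) ‖e‖| + |deriv lennardJones ‖e‖| / ‖e‖) * ‖w‖ ^ 2 := by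
  unfold Hess₀
  set c := inner ℝ e w / ‖e‖ with hc
  have hc2 : c ^ 2 ≤ ‖w‖ ^ 2 := by
    rcases eq_or_ne e 0 with rfl | he
    · simp [hc]
    · have hpos : 0 < ‖e‖ := norm_pos_iff.2 he
      have hcs : |inner ℝ e w| ≤ ‖e‖ * ‖w‖ := abs_real_inner_le_norm e w
      have : |c| ≤ ‖w‖ := by
        rw [hc, abs_div, abs_of_pos hpos, div_le_iff₀ hpos]; linarith [mul_comm ‖e‖ ‖w‖]
      nlinarith [abs_nonneg c, sq_abs c]
  have h1 : |deriv (deriv lennardJones) ‖e‖ * c ^ 2| ≤ |deriv (deriv lennardJones) ‖e‖| * ‖w‖ ^ 2 := by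
    rw [abs_mul, abs_of_nonneg (sq_nonneg c)]
    exact mul_le_mul_of_nonneg_left hc2 (abs_nonneg _)
  have h2 : |deriv lennardJones ‖e‖ / ‖e‖ * (‖w‖ ^ 2 - c ^ 2)| ≤
      |deriv lennardJones ‖e‖| / ‖e‖ * ‖w‖ ^ 2 := by
    rw [abs_mul, abs_div, abs_norm, abs_of_nonneg (sub_nonneg.2 hc2)]
    exact mul_le_mul_of_nonneg_left (by nlinarith [sq_nonneg c]) (by positivity)
  calc _ ≤ |deriv (deriv lennardJones) ‖e‖ * c ^ 2| + |deriv lennardJones ‖e‖ / ‖e‖ * (‖w‖ ^ 2 - c ^ 2)| :=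
        abs_add_le _ _
    _ ≤ _ := by linarith

/-- For `‖e‖ ≥ 1/2` and `‖w‖ = 1`: `|wᵀK(e)w| ≤ 904·‖e‖⁻⁸`. [folklore] -/
theorem abs_Hess₀_le_inv_pow {e w : E3} (he : (1 / 2 : ℝ) ≤ ‖e‖) (hw : ‖w‖ = 1) :
    |Hess₀ e w| ≤ 904 * (‖e‖⁻¹) ^ 8 := by
  have hpos : 0 < ‖e‖ := by linarith
  have hne : ‖e‖ ≠ 0 := hpos.ne'
  refine (abs_Hess₀_le e w).trans ?_
  rw [hw, one_pow, mul_one, deriv_deriv_lennardJones hne, deriv_lennardJones hne]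
  set x := ‖e‖⁻¹ with hx
  have hx0 : 0 < x := inv_pos.2 hpos
  have hx2 : x ≤ 2 := by rw [hx]; exact inv_le_of_inv_le₀ (by norm_num) (by simpa using he)
  have hdiv : |-(x ^ 13) + x ^ 7| / ‖e‖ = |-(x ^ 13) + x ^ 7| * x := by rw [hx, div_eq_mul_inv]
  rw [hdiv]
  have hA : |13 * x ^ 14 - 7 * x ^ 8| ≤ 13 * x ^ 14 + 7 * x ^ 8 := by
    refine abs_le.2 ⟨?_, ?_⟩ <;> nlinarith [pow_nonneg hx0.le 14, pow_nonneg hx0.le 8]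
  have hB : |-(x ^ 13) + x ^ 7| ≤ x ^ 13 + x ^ 7 := by
    refine abs_le.2 ⟨?_, ?_⟩ <;> nlinarith [pow_nonneg hx0.le 13, pow_nonneg hx0.le 7]
  have hx6 : x ^ 6 ≤ 64 := by
    calc x ^ 6 ≤ 2 ^ 6 := pow_le_pow_left₀ hx0.le hx2 6
      _ = 64 := by norm_num
  have h8 : 0 ≤ x ^ 8 := pow_nonneg hx0.le 8
  calc |13 * x ^ 14 - 7 * x ^ 8| + |-(x ^ 13) + x ^ 7| * x
      ≤ (13 * x ^ 14 + 7 * x ^ 8) + (x ^ 13 + x ^ 7) * x := by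
        gcongr
    _ = 14 * (x ^ 8 * x ^ 6) + 8 * x ^ 8 := by ring
    _ ≤ 14 * (x ^ 8 * 64) + 8 * x ^ 8 := by gcongr
    _ = 904 * x ^ 8 := by ring

/-! ### The forms over the mirror definitions -/

/-- The nearest-neighbour strain form is `≥ 0` (a `tsum` of squares). [folklore] -/
theorem nnForm_nonneg (t : Fin 2 → E3) (A : E3 →L[ℝ] E3) (u : E3 → E3) : 0 ≤ nnForm t A u :=
  tsum_nonneg fun _ => tsum_nonneg fun _ => by split_ifs <;> positivity

end Summit.AtomisticToContinuum.Crystallization.Cruxes.PhononStability.Disproof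

end


/-!
# `PhononStability` (stmt-AtomisticToContinuum-9333), negative side II: `Adm` is load-bearing

`PhononStabilityOn Inner₀` (the crux with the admissible-cell hypothesis `Adm A` deleted, i.e. the
window predicate `W t A = Inner t A` of part I) is FALSE: with `A = 0` the site set is the two points `0, e₁/40` (the inner-shift hypothesis still
holds), and the transverse displacement `e₂` at `0` has nearest-neighbour strain `2` but second
variation `40·V′(1/40) = −40¹⁴ + 40⁸ < 0` — the pure pre-stress term `V′(r)/r` of a hugely
compressed bond.  Hence no `κ > 0` works and any proof of the crux must USE `Adm` (at least to keep
bond lengths near `0.97`).  All `[folklore]`.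
-/

noncomputable section

namespace Summit.AtomisticToContinuum.Crystallization.Cruxes.PhononStability.Disproof

open scoped BigOperators Topology Classical InnerProductSpace
open Filter Set Function
open Literature.MathematicalPhysics.StatisticalMechanics
open Summit.AtomisticToContinuum.Crystallization.Theses.ExcessDecayLiouville

local notation "E3" => EuclideanSpace ℝ (Fin 3)

/-! ## The witness: `A = 0`, `t = (0, e₁/40)`, `u = e₂ · 𝟙_{0}` -/

/-- Inner shift of the witness, `d = e₁/40`. [folklore] -/
def dW : E3 := EuclideanSpace.single 0 (1 / 40 : ℝ)
/-- Transverse displacement of the witness, `w = e₂`. [folklore] -/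
def wW : E3 := EuclideanSpace.single 1 (1 : ℝ)
/-- Sublattice translations of the witness. [folklore] -/
def tW : Fin 2 → E3 := ![0, dW]
/-- Displacement field of the witness: `w` at the origin, `0` elsewhere. [folklore] -/
def uW : E3 → E3 := fun p => if p = 0 then wW else 0

/-- `‖d‖ = 1/40`. [folklore] -/
theorem norm_dW : ‖dW‖ = 1 / 40 := by
  rw [dW, PiLp.norm_single, Real.norm_eq_abs, abs_of_pos (by norm_num)]

/-- `‖w‖ = 1`. [folklore] -/
theorem norm_wW : ‖wW‖ = 1 := by
  rw [wW, PiLp.norm_single, norm_one]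

/-- `d ≠ 0`. [folklore] -/
theorem dW_ne_zero : dW ≠ 0 := by
  intro h; have := norm_dW; rw [h, norm_zero] at this; norm_num at this

/-- `w ≠ 0`. [folklore] -/
theorem wW_ne_zero : wW ≠ 0 := by
  intro h; have := norm_wW; rw [h, norm_zero] at this; norm_num at this

/-- `w ⊥ d`. [folklore] -/
theorem inner_dW_wW : inner ℝ dW wW = 0 := by
  simp [dW, wW, EuclideanSpace.inner_single_left]

/-- `u 0 = w`. [folklore] -/
theorem uW_zero : uW 0 = wW := if_pos rfl
/-- `u d = 0`. [folklore] -/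
theorem uW_dW : uW dW = 0 := if_neg dW_ne_zero

/-- `u` is supported in `{0}`. [folklore] -/
theorem support_uW : Function.support uW ⊆ {0} := by
  intro p hp
  by_contra h0
  exact hp (if_neg h0)

/-- The witness site set is `{0, d}`. [folklore] -/
theorem sites₀_tW : Sites₀ tW 0 = {0, dW} := by
  rw [sites₀_zero]; rfl

/-- The witness satisfies the inner-shift hypothesis (`‖d‖ = 1/40`). [folklore] -/
theorem inner₀_tW : Inner₀ tW 0 := by
  have h : tW 1 - tW 0 - (0 : E3 →L[ℝ] E3) (barlowOffset 1 + layerNormal (Real.sqrt (2 / 3))) = dW := by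
    simp [tW]
  rw [Inner₀, h, norm_dW]

/-- Nearest-neighbour strain of the witness: `2`. [folklore] -/
theorem nnForm_witness : nnForm tW 0 uW = 2 := by
  rw [nnForm, sites₀_tW, tsum_tsum_pair dW_ne_zero.symm
    (fun p q : E3 => if dist p q ≤ 11 / 10 then ‖uW p - uW q‖ ^ 2 else 0)]
  simp only [uW_zero, uW_dW, dist_self, dist_eq_norm, zero_sub, sub_zero, norm_neg, norm_dW,
    sub_self, norm_zero, norm_wW]
  norm_num

/-- Second-variation double sum of the witness: `80·V′(1/40)·40 = 80(−40¹³ + 40⁷)`. [folklore] -/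
theorem hessForm_witness : hessForm tW 0 uW = 80 * (-(40 : ℝ) ^ 13 + 40 ^ 7) := by
  rw [hessForm, sites₀_tW, tsum_tsum_pair dW_ne_zero.symm
    (fun p q : E3 => if p ≠ q then Hess₀ (p - q) (uW p - uW q) else 0)]
  have h1 : Hess₀ (0 - dW) (wW - 0) = 40 * (-(40 : ℝ) ^ 13 + 40 ^ 7) := by
    rw [zero_sub, sub_zero, Hess₀_of_inner_eq_zero (by rw [inner_neg_left, inner_dW_wW, neg_zero]),
      norm_neg, norm_dW, norm_wW, deriv_lennardJones (by norm_num)]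
    norm_num
  have h2 : Hess₀ (dW - 0) (0 - wW) = 40 * (-(40 : ℝ) ^ 13 + 40 ^ 7) := by
    rw [zero_sub, sub_zero, Hess₀_of_inner_eq_zero (by rw [inner_neg_right, inner_dW_wW, neg_zero]),
      norm_neg, norm_dW, norm_wW, deriv_lennardJones (by norm_num)]
    norm_num
  simp only [ne_eq, not_true_eq_false, if_false, dW_ne_zero, dW_ne_zero.symm, not_false_eq_true,
    if_true, uW_zero, uW_dW, h1, h2]
  ring

/-- **`Adm` is load-bearing.** Without the admissible-cell hypothesis the degenerate cell `A = 0`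
is allowed; the site set is then the two points `0, e₁/40`, and the transverse displacement `e₂`
at the origin has nearest-neighbour strain `2` but second variation
`40·V′(1/40) = -40¹⁴ + 40⁸ < 0` (pure pre-stress term of a hugely compressed bond). Hence no
`κ > 0` works: any proof of the crux must use `Adm` (at least to keep bond lengths near `0.97`). [folklore] -/
theorem phononStability_false_without_Adm : ¬ PhononStabilityOn fun t A => Inner₀ t A := by
  intro hP
  unfold PhononStabilityOn at hP
  obtain ⟨κ, hκ, h⟩ := hP
  have key := h tW 0 inner₀_tW uW ((Set.finite_singleton (0 : E3)).subset support_uW)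
    (support_uW.trans (by
      intro p hp
      rw [Set.mem_singleton_iff] at hp
      subst hp
      exact ⟨0, 0, zero_mem_Λ₀, by simp [tW]⟩))
  rw [nnForm_witness, hessForm_witness] at key
  have h40 : (40 : ℝ) ^ 7 < 40 ^ 13 := by norm_num
  nlinarith

end Summit.AtomisticToContinuum.Crystallization.Cruxes.PhononStability.Disproof

end


/-!
# `PhononStability` (stmt-AtomisticToContinuum-9333), negative side III: the coincident-sublattice witness as a periodic configuration

Geometry for part IV (`Inner` is load-bearing): the conformal cell `A₀ = 0.97·id` is admissible;
its period lattice `A₀Λ` is the tree's Barlow period lattice `L₀` of the alternating (hcp) Hägg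
sequence with `a = 0.97`, `h = 0.97√(2/3)`, period `2` (`mem_L₀_iff`), whose nonzero vectors
have norm `≥ 3/4` (`norm_ge_of_mem_L₀'`, from `le_dist_of_mem_barlowStacking`); with sublattice
translations `t = (0, δe₃)`, `0 < δ ≤ 1/4`, the site set of the crux is the point set of the
periodic configuration `Pδ` with motif `{0, δe₃}` (`sites₀_eq_points`), parametrised bijectively by
labels `Fin 2 × L₀` (`pos`, `param`, `tsum_tsum_points_eq`); far labels sit at distance `≥ ‖l‖/2`
and `≥ 1/2` from the origin (`norm_pos_ge`).  All `[folklore]`.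
-/

noncomputable section

namespace Summit.AtomisticToContinuum.Crystallization.Cruxes.PhononStability.Disproof

open scoped BigOperators Topology Classical InnerProductSpace
open Filter Set Function
open Literature.MathematicalPhysics.StatisticalMechanics
open Summit.AtomisticToContinuum.Crystallization.Theses.ExcessDecayLiouville

local notation "E3" => EuclideanSpace ℝ (Fin 3)

/-! ### The conformal cell `A₀ = 0.97·id` and its period lattice -/

/-- The relaxed conformal cell `A₀ = (97/100)·id`. [folklore] -/
def A₀ : E3 →L[ℝ] E3 := (97 / 100 : ℝ) • ContinuousLinearMap.id ℝ E3

/-- `A₀ z = 0.97·z`. [folklore] -/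
@[simp] theorem A₀_apply (z : E3) : A₀ z = (97 / 100 : ℝ) • z := rfl

/-- The conformal relaxed cell `A₀ = 0.97·id` is admissible (`R = id`, distance `0`). [folklore] -/
theorem adm₀_A₀ : Adm₀ A₀ := by
  refine ⟨LinearIsometryEquiv.refl ℝ E3, ?_⟩
  have h : A₀ - (97 / 100 : ℝ) •
      ((LinearIsometryEquiv.refl ℝ E3).toContinuousLinearEquiv : E3 →L[ℝ] E3) = 0 := by
    ext z i
    simp [A₀]
  rw [h, norm_zero]
  norm_num

/-- `0.97 ≠ 0`. [folklore] -/
theorem a97_ne : (97 / 100 : ℝ) ≠ 0 := by norm_num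
/-- `0.97·√(2/3) ≠ 0`. [folklore] -/
theorem h97_ne : (97 / 100 : ℝ) * Real.sqrt (2 / 3) ≠ 0 := by positivity

/-- The period lattice `A₀ Λ = ℤ(0.97u) + ℤ(0.97v) + ℤ(0.97·2√(2/3) e₃)`, as the tree's Barlow period
lattice of the alternating (hcp) Hägg sequence with `a = 0.97`, `h = 0.97√(2/3)`, period `2`. [folklore] -/
def L₀ : Submodule ℤ E3 :=
  barlowPeriodLattice alternatingHagg a97_ne h97_ne (two_ne_zero (α := ℕ))

/-- The alternating Hägg sequence has window sum `0` over one period (`1 + (−1)`). [folklore] -/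
theorem haggWindow_alt_two : haggWindow alternatingHagg 0 2 = 0 := by
  rw [haggWindow_alternating]; simp

/-- `A₀` maps the generators of the unit period lattice `Λ` to the Barlow period vectors with `a = 0.97`, `h = 0.97√(2/3)`, `p = 2`. [folklore] -/
theorem A₀_lattice_vec (i j k : ℤ) :
    A₀ ((i : ℝ) • triangularVec₁ 1 + (j : ℝ) • triangularVec₂ 1 +
      (k : ℝ) • layerNormal (2 * Real.sqrt (2 / 3))) =
    (i : ℝ) • triangularVec₁ (97 / 100) + (j : ℝ) • triangularVec₂ (97 / 100) +
      (k : ℝ) • ((haggWindow alternatingHagg 0 2 : ℝ) • barlowOffset (97 / 100) +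
        ((2 : ℕ) : ℝ) • layerNormal ((97 / 100 : ℝ) * Real.sqrt (2 / 3))) := by
  rw [haggWindow_alt_two, A₀_apply]
  ext l
  fin_cases l <;> simp [triangularVec₁, triangularVec₂, barlowOffset, layerNormal] <;> ring

/-- `L₀ = A₀(Λ)` as sets. [folklore] -/
theorem mem_L₀_iff (g : E3) : g ∈ L₀ ↔ ∃ z ∈ Λ₀, g = A₀ z := by
  constructor
  · intro hg
    obtain ⟨n₀, n₁, n₂, rfl⟩ := exists_eq_of_mem_barlowPeriodLattice _ a97_ne h97_ne two_ne_zero hg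
    exact ⟨_, ⟨n₀, n₁, n₂, rfl⟩, (A₀_lattice_vec n₀ n₁ n₂).symm⟩
  · rintro ⟨z, ⟨i, j, k, rfl⟩, rfl⟩
    rw [A₀_lattice_vec]
    exact sum_smul_mem_barlowPeriodLattice _ a97_ne h97_ne two_ne_zero i j k

/-- Nonzero period vectors are long: `‖g‖ ≥ 0.97·√(2/3)` (they are distinct points of the hcp
stacking with spacings `a = 0.97`, `h = 0.97√(2/3)`). [folklore] -/
theorem norm_ge_of_mem_L₀ {g : E3} (hg : g ∈ L₀) (hg0 : g ≠ 0) :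
    (97 / 100 : ℝ) * Real.sqrt (2 / 3) ≤ ‖g‖ := by
  have hpts : g ∈ (hcpPeriodicConfiguration a97_ne h97_ne).points := by
    refine ⟨barlowPos (97 / 100) ((97 / 100 : ℝ) * Real.sqrt (2 / 3)) alternatingHagg 0 0 0,
      ?_, g, hg, ?_⟩
    · show _ ∈ (Finset.range 2).image _
      exact Finset.mem_image.2 ⟨0, by simp, by simp⟩
    · simp [barlowPos]
  rw [hcpPeriodicConfiguration_points] at hpts
  have h0 : (0 : E3) ∈ hcpStacking (97 / 100) ((97 / 100 : ℝ) * Real.sqrt (2 / 3)) :=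
    ⟨0, 0, 0, by simp [barlowPos]⟩
  have := le_dist_of_mem_barlowStacking (97 / 100) ((97 / 100 : ℝ) * Real.sqrt (2 / 3))
    alternatingHagg (by norm_num) (by positivity) h0 hpts hg0.symm
  rw [dist_eq_norm, zero_sub, norm_neg] at this
  refine le_trans ?_ this
  apply le_min
  · have : Real.sqrt (2 / 3) ≤ 1 := Real.sqrt_le_one.2 (by norm_num)
    nlinarith
  · exact le_rfl

/-! ### The witness configuration: motif `{0, δe₃}` over `L₀` -/

/-- Vertical inner shift `d = δ e₃`. [folklore] -/
def dV (δ : ℝ) : E3 := EuclideanSpace.single 2 δ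

/-- `‖δe₃‖ = δ` for `δ ≥ 0`. [folklore] -/
theorem norm_dV {δ : ℝ} (hδ : 0 ≤ δ) : ‖dV δ‖ = δ := by
  rw [dV, PiLp.norm_single, Real.norm_eq_abs, abs_of_nonneg hδ]

/-- `δe₃ ≠ 0` for `δ > 0`. [folklore] -/
theorem dV_ne_zero {δ : ℝ} (hδ : 0 < δ) : dV δ ≠ 0 := by
  intro h; have := norm_dV hδ.le; rw [h, norm_zero] at this; exact hδ.ne' this.symm

/-- `√(2/3) ≥ 4/5`. [folklore] -/
theorem sqrt_two_thirds_ge : (4 / 5 : ℝ) ≤ Real.sqrt (2 / 3) :=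
  Real.le_sqrt_of_sq_le (by norm_num)

/-- Nonzero period vectors have norm `≥ 3/4`. [folklore] -/
theorem norm_ge_of_mem_L₀' {g : E3} (hg : g ∈ L₀) (hg0 : g ≠ 0) : (3 / 4 : ℝ) ≤ ‖g‖ :=
  le_trans (by nlinarith [sqrt_two_thirds_ge]) (norm_ge_of_mem_L₀ hg hg0)

/-- A short vertical shift is not a period: `δe₃ ∉ L₀` for `0 < δ ≤ 1/4`. [folklore] -/
theorem dV_not_mem_L₀ {δ : ℝ} (h0 : 0 < δ) (h1 : δ ≤ 1 / 4) : dV δ ∉ L₀ := fun h => by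
  have := norm_ge_of_mem_L₀' h (dV_ne_zero h0)
  rw [norm_dV h0.le] at this
  linarith

/-- The periodic configuration with period lattice `L₀` and motif `{0, δe₃}` (`0 < δ ≤ 1/4`). [folklore] -/
def Pδ (δ : ℝ) (h0 : 0 < δ) (h1 : δ ≤ 1 / 4) : PeriodicConfiguration 3 where
  lattice := L₀
  discrete := by unfold L₀ barlowPeriodLattice; infer_instance
  isZLattice := by unfold L₀ barlowPeriodLattice; infer_instance
  motif := {0, dV δ}
  motif_nonempty := by simp
  eq_of_sub_mem := by
    intro x hx y hy hxy
    simp only [Finset.mem_insert, Finset.mem_singleton] at hx hy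
    rcases hx with rfl | rfl <;> rcases hy with rfl | rfl
    · rfl
    · exact absurd (by simpa using L₀.neg_mem hxy) (dV_not_mem_L₀ h0 h1)
    · exact absurd (by simpa using hxy) (dV_not_mem_L₀ h0 h1)
    · rfl

/-- Sublattice translations of the witness: `t = (0, δe₃)`. [folklore] -/
def tV (δ : ℝ) : Fin 2 → E3 := ![0, dV δ]

/-- `t 0 = 0`. [folklore] -/
@[simp] theorem tV_zero (δ : ℝ) : tV δ 0 = 0 := rfl
/-- `t 1 = δe₃`. [folklore] -/
@[simp] theorem tV_one (δ : ℝ) : tV δ 1 = dV δ := rfl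

/-- The witness site set is the point set of the periodic configuration `Pδ`. [folklore] -/
theorem sites₀_eq_points (δ : ℝ) (h0 : 0 < δ) (h1 : δ ≤ 1 / 4) :
    Sites₀ (tV δ) A₀ = (Pδ δ h0 h1).points := by
  ext p
  simp only [Sites₀, PeriodicConfiguration.points, Pδ, Set.mem_setOf_eq, Finset.mem_insert,
    Finset.mem_singleton]
  constructor
  · rintro ⟨m, z, hz, rfl⟩
    refine ⟨tV δ m, ?_, A₀ z, (mem_L₀_iff _).2 ⟨z, hz, rfl⟩, rfl⟩
    fin_cases m <;> simp
  · rintro ⟨y, hy, g, hg, rfl⟩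
    obtain ⟨z, hz, rfl⟩ := (mem_L₀_iff g).1 hg
    rcases hy with rfl | rfl
    · exact ⟨0, z, hz, by simp⟩
    · exact ⟨1, z, hz, by simp⟩

/-! ### Parametrising the witness sites by `Fin 2 × L₀` -/

section Param

variable {δ : ℝ}

/-- `‖t m‖ ≤ δ`. [folklore] -/
theorem norm_tV_le (hδ : 0 ≤ δ) (m : Fin 2) : ‖tV δ m‖ ≤ δ := by
  fin_cases m
  · simp [hδ]
  · simp [norm_dV hδ]

/-- Both translations are motif points of `Pδ`. [folklore] -/
theorem tV_mem_motif (h0 : 0 < δ) (h1 : δ ≤ 1 / 4) (m : Fin 2) : tV δ m ∈ (Pδ δ h0 h1).motif := by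
  fin_cases m <;> simp [Pδ]

/-- `t 0 ≠ t 1`. [folklore] -/
theorem tV_injective (h0 : 0 < δ) : Function.Injective (tV δ) := by
  intro m m' h
  fin_cases m <;> fin_cases m'
  · rfl
  · exact absurd h.symm (by simpa using dV_ne_zero h0)
  · exact absurd h (by simpa using dV_ne_zero h0)
  · rfl

/-- Position of the site with label `(m, l)`: `t_m + l`. [folklore] -/
def pos (δ : ℝ) (a : Fin 2 × L₀) : E3 := tV δ a.1 + (a.2 : E3)

/-- Labels determine sites: `(m, l) ↦ t m + l` is injective (motif points are inequivalent mod `L₀`). [folklore] -/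
theorem pos_injective (h0 : 0 < δ) (h1 : δ ≤ 1 / 4) : Function.Injective (pos δ) := by
  rintro ⟨m, l⟩ ⟨m', l'⟩ h
  simp only [pos] at h
  have hsub : tV δ m - tV δ m' = (l' : E3) - l := by
    rw [sub_eq_sub_iff_add_eq_add, h, add_comm]
  have hmem : tV δ m - tV δ m' ∈ L₀ := by rw [hsub]; exact L₀.sub_mem l'.2 l.2
  have hm : tV δ m = tV δ m' :=
    (Pδ δ h0 h1).eq_of_sub_mem _ (tV_mem_motif h0 h1 m) _ (tV_mem_motif h0 h1 m') hmem
  obtain rfl : m = m' := tV_injective h0 hm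
  have hl : (l : E3) = l' := add_left_cancel h
  exact Prod.ext rfl (Subtype.ext hl)

/-- Every label gives a point of `Pδ`. [folklore] -/
theorem pos_mem (h0 : 0 < δ) (h1 : δ ≤ 1 / 4) (a : Fin 2 × L₀) : pos δ a ∈ (Pδ δ h0 h1).points :=
  ⟨tV δ a.1, tV_mem_motif h0 h1 a.1, a.2, a.2.2, rfl⟩

/-- The parametrisation of the point set of `Pδ` by labels. [folklore] -/
def param (h0 : 0 < δ) (h1 : δ ≤ 1 / 4) (a : Fin 2 × L₀) : (Pδ δ h0 h1).points := ⟨pos δ a, pos_mem h0 h1 a⟩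

/-- The parametrisation is injective. [folklore] -/
theorem param_injective (h0 : 0 < δ) (h1 : δ ≤ 1 / 4) : Function.Injective (param h0 h1) := fun _ _ h =>
  pos_injective h0 h1 (congrArg Subtype.val h)

/-- The parametrisation is surjective. [folklore] -/
theorem range_param (h0 : 0 < δ) (h1 : δ ≤ 1 / 4) : Set.range (param h0 h1) = Set.univ := by
  refine Set.eq_univ_of_forall fun q => ?_
  obtain ⟨y, hy, g, hg, hq⟩ := q.2
  simp only [Pδ, Finset.mem_insert, Finset.mem_singleton] at hy
  rcases hy with rfl | rfl
  · exact ⟨(0, ⟨g, hg⟩), Subtype.ext (by simp [param, pos, hq])⟩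
  · exact ⟨(1, ⟨g, hg⟩), Subtype.ext (by simp [param, pos, hq])⟩

/-- Reindexing a double site sum by labels. [folklore] -/
theorem tsum_tsum_points_eq (h0 : 0 < δ) (h1 : δ ≤ 1 / 4) (F : E3 → E3 → ℝ) :
    ∑' p : (Pδ δ h0 h1).points, ∑' q : (Pδ δ h0 h1).points, F p q =
      ∑' a : Fin 2 × L₀, ∑' b : Fin 2 × L₀, F (pos δ a) (pos δ b) := by
  have hr : ∀ (f : (Pδ δ h0 h1).points → ℝ), Function.support f ⊆ Set.range (param h0 h1) :=
    fun f => by rw [range_param]; exact Set.subset_univ _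
  rw [← (param_injective h0 h1).tsum_eq (hr _)]
  refine tsum_congr fun a => ?_
  rw [← (param_injective h0 h1).tsum_eq (hr _)]
  rfl

/-- The label of the origin and of the shifted origin. [folklore] -/
def o₀ : Fin 2 × L₀ := (0, 0)
/-- The label of the shifted origin `δe₃`. [folklore] -/
def a₁ : Fin 2 × L₀ := (1, 0)

/-- `pos o₀ = 0`. [folklore] -/
@[simp] theorem pos_o₀ : pos δ o₀ = 0 := by simp [pos, o₀]
/-- `pos a₁ = δe₃`. [folklore] -/
@[simp] theorem pos_a₁ : pos δ a₁ = dV δ := by simp [pos, a₁]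
/-- `o₀ ≠ a₁`. [folklore] -/
theorem o₀_ne_a₁ : o₀ ≠ a₁ := by simp [o₀, a₁]

/-- Only the label `o₀` sits at the origin. [folklore] -/
theorem pos_eq_zero_iff (h0 : 0 < δ) (h1 : δ ≤ 1 / 4) {a : Fin 2 × L₀} :
    pos δ a = 0 ↔ a = o₀ := by
  constructor
  · intro h; exact pos_injective h0 h1 (h.trans pos_o₀.symm)
  · rintro rfl; exact pos_o₀

/-- A label other than `o₀, a₁` has a nonzero period component. [folklore] -/
theorem snd_ne_zero_of_ne {a : Fin 2 × L₀} (ha : a ≠ o₀) (ha' : a ≠ a₁) : (a.2 : E3) ≠ 0 := by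
  intro h
  have h2 : a.2 = 0 := Subtype.ext h
  obtain ⟨m, l⟩ := a
  simp only at h2
  subst h2
  fin_cases m
  · exact ha rfl
  · exact ha' rfl

/-- Far sites are at distance `≥ ‖l‖/2` and `≥ 1/2` from the origin. [folklore] -/
theorem norm_pos_ge (h0 : 0 < δ) (h1 : δ ≤ 1 / 4) {a : Fin 2 × L₀} (ha : a ≠ o₀) (ha' : a ≠ a₁) :
    ‖(a.2 : E3)‖ / 2 ≤ ‖pos δ a‖ ∧ (1 / 2 : ℝ) ≤ ‖pos δ a‖ := by
  have hl : (3 / 4 : ℝ) ≤ ‖(a.2 : E3)‖ := norm_ge_of_mem_L₀' a.2.2 (snd_ne_zero_of_ne ha ha')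
  have ht : ‖tV δ a.1‖ ≤ 1 / 4 := (norm_tV_le h0.le a.1).trans h1
  have hge : ‖(a.2 : E3)‖ - ‖tV δ a.1‖ ≤ ‖pos δ a‖ := by
    have := norm_sub_norm_le (a.2 : E3) (-(tV δ a.1))
    rw [norm_neg, sub_neg_eq_add, add_comm] at this
    simpa [pos] using this
  constructor <;> linarith

end Param

end Summit.AtomisticToContinuum.Crystallization.Cruxes.PhononStability.Disproof

end


/-!
# `PhononStability` (stmt-AtomisticToContinuum-9333), negative side IV: `Inner` is load-bearing

`PhononStabilityOn (fun _ A => Adm₀ A)` (the crux with the inner-shift hypothesis `Inner t A`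
deleted, i.e. the window predicate `W t A = Adm A` of part I) is FALSE.  Witness (part III): cell `A₀ = 0.97·id`, translations `t = (0, δe₃)` (second
sublattice almost on top of the first), displacement `e₁·𝟙_{0}`.  The rows of the
second-variation double sum are `Σ H` (origin) and `H a` (label `a ≠` origin), with
`H(a) = e₁ᵀK(pos a)e₁`, so `hessForm = 2ΣH` (`hessForm_eq`); the far part of `ΣH` is bounded by
the `δ`-FREE constant `M = Σ_{(m,l)} 904·2⁸‖l‖⁻⁸` (Mathlib `ZLattice.summable_norm_sub_inv_pow`)
and the near pair gives `V′(δ)/δ = −δ⁻¹⁴ + δ⁻⁸` (`tsum_H_le`); for `δ = min(1/4, 1/(M+1))` the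
second variation is negative while the strain form is `≥ 0`
(`phononStability_false_without_Inner`).  So any proof of the crux must USE `Inner` (at least
to keep the two sublattices apart).  All `[folklore]`.
-/

noncomputable section

namespace Summit.AtomisticToContinuum.Crystallization.Cruxes.PhononStability.Disproof

open scoped BigOperators Topology Classical InnerProductSpace
open Filter Set Function
open Literature.MathematicalPhysics.StatisticalMechanics
open Summit.AtomisticToContinuum.Crystallization.Theses.ExcessDecayLiouville

local notation "E3" => EuclideanSpace ℝ (Fin 3)

/-! ### The displacement and the row structure of the second variation -/

/-- Transverse displacement `w = e₁`. [folklore] -/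
def wV : E3 := EuclideanSpace.single 0 (1 : ℝ)
/-- Displacement field: `w` at the origin, `0` elsewhere. [folklore] -/
def uV : E3 → E3 := fun p => if p = 0 then wV else 0

/-- `‖e₁‖ = 1`. [folklore] -/
theorem norm_wV : ‖wV‖ = 1 := by rw [wV, PiLp.norm_single, norm_one]

/-- `e₁ ⊥ δe₃`. [folklore] -/
theorem inner_dV_wV (δ : ℝ) : inner ℝ (dV δ) wV = 0 := by
  simp [dV, wV, EuclideanSpace.inner_single_left]

/-- `u` is supported in `{0}`. [folklore] -/
theorem support_uV : Function.support uV ⊆ {0} := by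
  intro p hp; by_contra h; exact hp (if_neg h)

/-- The near pair: `wᵀK(δe₃)w = V′(δ)/δ = −δ⁻¹⁴ + δ⁻⁸`. [folklore] -/
theorem Hess₀_dV_wV {δ : ℝ} (h0 : 0 < δ) :
    Hess₀ (dV δ) wV = -(δ⁻¹) ^ 14 + (δ⁻¹) ^ 8 := by
  rw [Hess₀_of_inner_eq_zero (inner_dV_wV δ), norm_dV h0.le, norm_wV,
    deriv_lennardJones h0.ne', div_eq_mul_inv]
  ring

/-! ### Row structure, majorant, and the value of the second variation -/

section Rows

variable {δ : ℝ}

/-- `L₀` is discrete (it is the `ℤ`-span of a basis). [folklore] -/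
instance : DiscreteTopology L₀ := by unfold L₀ barlowPeriodLattice; infer_instance
/-- `L₀` is a full lattice (it is the `ℤ`-span of a basis). [folklore] -/
instance : IsZLattice ℝ L₀ := by unfold L₀ barlowPeriodLattice; infer_instance

/-- The row function: `H(a) = wᵀ K(pos a) w` off the origin, `0` at the origin. [folklore] -/
def H (δ : ℝ) (a : Fin 2 × L₀) : ℝ := if a = o₀ then 0 else Hess₀ (pos δ a) wV

/-- The `δ`-free majorant `B(m, l) = 904·2⁸·‖l‖⁻⁸`. [folklore] -/
def B (a : Fin 2 × L₀) : ℝ := 231424 * (‖(a.2 : E3)‖⁻¹) ^ 8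

/-- `B ≥ 0`. [folklore] -/
theorem B_nonneg (a : Fin 2 × L₀) : 0 ≤ B a := by unfold B; positivity

/-- `rank L₀ = 3`. [folklore] -/
theorem finrank_L₀ : Module.finrank ℤ L₀ = 3 := by
  rw [ZLattice.rank ℝ L₀, finrank_euclideanSpace, Fintype.card_fin]

/-- `B` is summable over `Fin 2 × L₀` (`‖l‖⁻⁸` over a rank-3 lattice, Mathlib `ZLattice.summable_norm_sub_inv_pow`). [folklore] -/
theorem summable_B : Summable B := by
  have hs : Summable fun l : L₀ => ‖(l : E3) - 0‖⁻¹ ^ 8 :=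
    ZLattice.summable_norm_sub_inv_pow L₀ 8 (by rw [finrank_L₀]; norm_num) 0
  simp only [sub_zero] at hs
  have h2 : ∀ m : Fin 2, Summable fun l : L₀ => B (m, l) := fun m => hs.mul_left 231424
  exact (summable_prod_of_nonneg fun a => B_nonneg a).2 ⟨h2, .of_finite⟩

/-- The `δ`-free constant bounding the far field. [folklore] -/
def M : ℝ := ∑' a : Fin 2 × L₀, B a

/-- `M ≥ 0`. [folklore] -/
theorem M_nonneg : 0 ≤ M := tsum_nonneg B_nonneg

/-- Termwise domination `|H a| ≤ B a` off the near label `a₁` (far sites are at distance `≥ ‖l‖/2 ≥ … ≥ 1/2`). [folklore] -/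
theorem abs_H_le_B (h0 : 0 < δ) (h1 : δ ≤ 1 / 4) {a : Fin 2 × L₀} (ha1 : a ≠ a₁) :
    |H δ a| ≤ B a := by
  unfold H
  split_ifs with ha
  · rw [abs_zero]; exact B_nonneg a
  · obtain ⟨hge, hhalf⟩ := norm_pos_ge h0 h1 ha ha1
    have hl0 : 0 < ‖(a.2 : E3)‖ := norm_pos_iff.2 (snd_ne_zero_of_ne ha ha1)
    have hp0 : 0 < ‖pos δ a‖ := by linarith
    calc |Hess₀ (pos δ a) wV| ≤ 904 * (‖pos δ a‖⁻¹) ^ 8 := abs_Hess₀_le_inv_pow hhalf norm_wV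
      _ ≤ 904 * ((‖(a.2 : E3)‖ / 2)⁻¹) ^ 8 := by
          gcongr
      _ = B a := by
          unfold B
          rw [inv_div, div_eq_mul_inv, mul_pow]
          ring

/-- The far part of the row function. [folklore] -/
def H₂ (δ : ℝ) (a : Fin 2 × L₀) : ℝ := if a = a₁ then 0 else H δ a

/-- `|H₂| ≤ B` everywhere. [folklore] -/
theorem abs_H₂_le_B (h0 : 0 < δ) (h1 : δ ≤ 1 / 4) (a : Fin 2 × L₀) : |H₂ δ a| ≤ B a := by
  unfold H₂
  split_ifs with ha
  · rw [abs_zero]; exact B_nonneg a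
  · exact abs_H_le_B h0 h1 ha

/-- The far part is summable. [folklore] -/
theorem summable_H₂ (h0 : 0 < δ) (h1 : δ ≤ 1 / 4) : Summable (H₂ δ) :=
  Summable.of_norm_bounded summable_B fun a => by
    rw [Real.norm_eq_abs]; exact abs_H₂_le_B h0 h1 a

/-- The far part is bounded by the `δ`-free constant: `Σ H₂ ≤ M`. [folklore] -/
theorem tsum_H₂_le (h0 : 0 < δ) (h1 : δ ≤ 1 / 4) : ∑' a, H₂ δ a ≤ M :=
  Summable.tsum_le_tsum (fun a => (le_abs_self _).trans (abs_H₂_le_B h0 h1 a))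
    (summable_H₂ h0 h1) summable_B

/-- `H = (near pair) + H₂`. [folklore] -/
theorem H_eq_add (a : Fin 2 × L₀) :
    H δ a = (if a = a₁ then Hess₀ (dV δ) wV else 0) + H₂ δ a := by
  unfold H₂ H
  by_cases ha : a = a₁
  · subst ha
    simp [o₀_ne_a₁.symm]
  · simp [ha]

/-- The row function `H` is summable. [folklore] -/
theorem summable_H (h0 : 0 < δ) (h1 : δ ≤ 1 / 4) : Summable (H δ) := by
  have : H δ = fun a => (if a = a₁ then Hess₀ (dV δ) wV else 0) + H₂ δ a :=
    funext H_eq_add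
  rw [this]
  exact (hasSum_ite_eq a₁ _).summable.add (summable_H₂ h0 h1)

/-- **The far field is bounded uniformly in `δ`:** `Σ H ≤ V′(δ)/δ + M`. [folklore] -/
theorem tsum_H_le (h0 : 0 < δ) (h1 : δ ≤ 1 / 4) :
    ∑' a, H δ a ≤ -(δ⁻¹) ^ 14 + (δ⁻¹) ^ 8 + M := by
  have : H δ = fun a => (if a = a₁ then Hess₀ (dV δ) wV else 0) + H₂ δ a :=
    funext H_eq_add
  rw [this, ((hasSum_ite_eq a₁ _).summable).tsum_add (summable_H₂ h0 h1), tsum_ite_eq,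
    Hess₀_dV_wV h0]
  linarith [tsum_H₂_le h0 h1]

/-- `u(pos b) = e₁` exactly at the origin label. [folklore] -/
theorem uV_pos (h0 : 0 < δ) (h1 : δ ≤ 1 / 4) (b : Fin 2 × L₀) :
    uV (pos δ b) = if b = o₀ then wV else 0 := by
  unfold uV
  simp only [pos_eq_zero_iff h0 h1]

/-- **Row sums of the second variation**: the origin row is `Σ H`, every other row `a` is `H a`. [folklore] -/
theorem row_eq (h0 : 0 < δ) (h1 : δ ≤ 1 / 4) (a : Fin 2 × L₀) :
    (∑' b : Fin 2 × L₀, if pos δ a ≠ pos δ b then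
        Hess₀ (pos δ a - pos δ b) (uV (pos δ a) - uV (pos δ b)) else 0) =
      if a = o₀ then ∑' b, H δ b else H δ a := by
  by_cases ha : a = o₀
  · subst ha
    rw [if_pos rfl]
    refine tsum_congr fun b => ?_
    by_cases hb : b = o₀
    · subst hb; simp [H]
    · have hpb : pos δ b ≠ 0 := fun h => hb ((pos_eq_zero_iff h0 h1).1 h)
      rw [uV_pos h0 h1, uV_pos h0 h1, if_pos rfl, if_neg hb, pos_o₀, if_pos (Ne.symm hpb),
        zero_sub, sub_zero, Hess₀_neg_left]
      simp [H, hb]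
  · rw [if_neg ha]
    have hpa : pos δ a ≠ 0 := fun h => ha ((pos_eq_zero_iff h0 h1).1 h)
    have hsum : (fun b : Fin 2 × L₀ => if pos δ a ≠ pos δ b then
        Hess₀ (pos δ a - pos δ b) (uV (pos δ a) - uV (pos δ b)) else 0) =
        fun b => if b = o₀ then H δ a else 0 := by
      funext b
      rw [uV_pos h0 h1, uV_pos h0 h1, if_neg ha]
      by_cases hb : b = o₀
      · subst hb
        rw [if_pos rfl, if_pos rfl, pos_o₀, if_pos hpa, sub_zero, zero_sub, Hess₀_neg_right]
        simp [H, ha]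
      · rw [if_neg hb, if_neg hb, sub_zero, Hess₀_zero_right, ite_self]
    rw [hsum, tsum_ite_eq]

/-- **The second variation of the witness is twice the row sum `Σ H`.** [folklore] -/
theorem hessForm_eq (h0 : 0 < δ) (h1 : δ ≤ 1 / 4) :
    hessForm (tV δ) A₀ uV = 2 * ∑' a, H δ a := by
  unfold hessForm
  rw [sites₀_eq_points δ h0 h1, tsum_tsum_points_eq h0 h1
    (fun p q => if p ≠ q then Hess₀ (p - q) (uV p - uV q) else 0)]
  rw [show (fun a : Fin 2 × L₀ => ∑' b : Fin 2 × L₀, if pos δ a ≠ pos δ b then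
        Hess₀ (pos δ a - pos δ b) (uV (pos δ a) - uV (pos δ b)) else 0) =
      fun a => H δ a + if a = o₀ then ∑' b, H δ b else 0 from ?_]
  · rw [(summable_H h0 h1).tsum_add (hasSum_ite_eq o₀ _).summable, tsum_ite_eq]
    ring
  · funext a
    rw [row_eq h0 h1 a]
    by_cases ha : a = o₀
    · subst ha; simp [H]
    · simp [ha]

end Rows

/-! ### The refutation -/

/-- **`Inner` is load-bearing.** Without the inner-shift hypothesis the second sublattice may sit
at `δe₃` on top of the first (cell `A = 0.97·id` admissible); the transverse displacement `e₁`
at the origin then has second variation `2(V′(δ)/δ + far field)` with the far field bounded by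
the `δ`-free lattice constant `M`, and `V′(δ)/δ = −δ⁻¹⁴ + δ⁻⁸ → −∞`: negative for
`δ = min(1/4, 1/(M+1))`, while the strain form is `≥ 0`. [folklore] -/
theorem phononStability_false_without_Inner : ¬ PhononStabilityOn fun _ A => Adm₀ A := by
  intro hP
  unfold PhononStabilityOn at hP
  obtain ⟨κ, hκ, h⟩ := hP
  have hM := M_nonneg
  set δ : ℝ := min (1 / 4) (1 / (M + 1)) with hδ
  have h0 : 0 < δ := lt_min (by norm_num) (by positivity)
  have h1 : δ ≤ 1 / 4 := min_le_left _ _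
  have h1' : δ ≤ 1 / (M + 1) := min_le_right _ _
  have hsupp : Function.support uV ⊆ Sites₀ (tV δ) A₀ := support_uV.trans (by
    intro p hp
    rw [Set.mem_singleton_iff] at hp
    subst hp
    exact ⟨0, 0, zero_mem_Λ₀, by simp⟩)
  have key := h (tV δ) A₀ adm₀_A₀ uV ((Set.finite_singleton (0 : E3)).subset support_uV) hsupp
  rw [hessForm_eq h0 h1] at key
  have hH := tsum_H_le h0 h1
  have hnn := nnForm_nonneg (tV δ) A₀ uV
  have hx4 : (4 : ℝ) ≤ δ⁻¹ := by
    have := inv_anti₀ h0 h1; norm_num at this; exact this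
  have hxM : M + 1 ≤ δ⁻¹ := by
    have := inv_anti₀ h0 h1'; rwa [one_div, inv_inv] at this
  have hx1 : (1 : ℝ) ≤ δ⁻¹ := by linarith
  have hx6 : (4096 : ℝ) ≤ (δ⁻¹) ^ 6 := by
    calc (4096 : ℝ) = 4 ^ 6 := by norm_num
      _ ≤ (δ⁻¹) ^ 6 := pow_le_pow_left₀ (by norm_num) hx4 6
  have hx8 : M + 1 ≤ (δ⁻¹) ^ 8 := hxM.trans (le_self_pow₀ hx1 (by norm_num))
  have h14 : (δ⁻¹) ^ 14 = (δ⁻¹) ^ 8 * (δ⁻¹) ^ 6 := by ring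
  have hA : (δ⁻¹) ^ 8 * 4096 ≤ (δ⁻¹) ^ 8 * (δ⁻¹) ^ 6 :=
    mul_le_mul_of_nonneg_left hx6 (by positivity)
  rw [h14] at hH
  have hκnn : 0 ≤ κ * nnForm (tV δ) A₀ uV := mul_nonneg hκ.le hnn
  linarith

end Summit.AtomisticToContinuum.Crystallization.Cruxes.PhononStability.Disproof

end

noncomputable section

namespace Summit.AtomisticToContinuum.Crystallization.Cruxes.PhononStability.Disproof

open scoped BigOperators Topology Classical InnerProductSpace
open Filter Set Function
open Literature.MathematicalPhysics.StatisticalMechanics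
open Summit.AtomisticToContinuum.Crystallization.Theses.ExcessDecayLiouville

local notation "E3" => EuclideanSpace ℝ (Fin 3)

/-! ## Part V — Numerics: the crux itself resists; where it is tight (workfile only)

All float / pure python (scripts + JSON in the disprover's folder `phonon/`, attached as item
evidence `phonon-numerics.md`): `pure_bloch.py` (the 6×6 Bloch pencil `(D(k), N(k))` of the typed
inequality per cell: `v*D v` = ½Σ Hess rows, `v*N v` = NN form; WLOG `A = 0.97(I+E)`, `E`
symmetric, `‖E‖op ≤ (1/40)/0.97`, shift `|d| ≤ 1/40` — exact cover of the window by polar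
decomposition + Weyl), `longwave.py` (the exact `k → 0` limit: 6×6 pencil of the (acoustic `k²`,
cross `k`, optical `1`) blocks), `local_search.py` / `refine_search.py` / `longwave.py` (adversarial
(1+λ)-ES over the 9-dim window, 64 runs), `crosscheck.py` (K(e) against finite differences of
`V(|e+sw|)`; real-space enveloped-wave evaluation of the typed inequality with an explicit finitely
supported `u`).  Lattice sums to `r ≤ 4.8 / 6.5 / 7`; tails move κ by `< 1e-3`.

RESULTS
* relaxed ideal cell: `κ* = min_k λ_gen = 0.466` (earlier refuters 0.457/0.46 ✓); dilation corner
  `A = 0.995·R`: `0.309`; all axis-aligned corners (earlier refuters): `≥ 0.28`.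
* ADVERSARIAL MINIMUM over the window: `κ_min ≈ 0.105` (64 independent ES runs plateau at
  0.1053–0.110; finite-`k` and long-wave searches agree), attained at an EXTREME point of the
  window: principal stretches `(0.945, 0.945, 0.995)` (two compressive + one tensile, all at the
  limit) with principal axes TILTED against the crystal (mixed basal/prismatic shear, e.g.
  `E ≈ diag(−.013,−.022,+.009)`, `E_xz ≈ .021`, `E_yz ≈ .012`), inner shift `|d| = 1/40` mostly
  along `c` (`d ≈ (.011,.006,.021)`); soft mode = long-wave quasi-transverse ACOUSTIC branch,
  `k̂ ≈ (0.85, 0.50, 0.19)` and hexagonal images — loss of margin in the prestressed,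
  internally-relaxed acoustic tensor, not an optical / zone-boundary mode.
* OTHER SECTORS: structured scan of 11200 extreme points (`E = ε₀·R·diag(±1,±1,±1)·Rᵀ` × 14 shift
  directions): worst pattern = two compressive + one tensile (0.115, refined by ES to 0.105); `(+,0,−)`:
  0.150; two tensile + one compressive: 0.163; all-± ≥ 0.17.  Short wavelengths (`|k|_BZ ≥ 0.6`,
  adversarial): min 0.183, attained at the inner boundary `|k|_BZ = 0.6` on the acoustic branch (no
  zone-boundary pocket); optical Γ block (adversarial): min 0.373 (all-tensile corner, in-plane
  shift).  The statement is decided in the long-wave acoustic corner only.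
* TIGHTNESS: scaling the worst datum `(E, d) ↦ λ(E, d)`: `κ_lw(1.0) = +0.106`, `κ_lw(1.25) = −0.003`,
  `κ_lw(4/3) = −0.036`, `κ_lw(1.5) = −0.098`, `κ_lw(2) = −0.26` (critical factor ≈ 1.24, i.e. radius ≈ 1/32.3): the admissible window sits within a factor ≈ 1.24 of a
  genuine harmonic (elastic) instability of strained + shifted LJ hcp.  The typed radius `1/40`
  survives; `1/32` would not.  'Shrink the window' repairs have room only downwards, and any
  enlargement of the matching tolerance in CoarseGrains / HcpLiouville beyond ≈ 1/32 loses
  PhononStability.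
* DECOMPOSITION of the tightness: strain corner alone (`d = 0`): `κ_lw = 0.365` (needs ×2.2 to
  destabilise); shift alone (`E = 0`, `|d| = 1/40`): `0.325` (needs ×2.4); COMBINED: `0.106`
  (×1.24).  The RELAXED inner shift at the worst strain `E*` is tiny (`|d_rel| = 6.5e-4`,
  `κ_lw(E*, d_rel) = 0.36`): the admissible shift `1/40` is essentially all off-equilibrium, and
  that is what makes the typed statement tight.  Cheap robustness repair if ever needed (planner):
  restrict `Inner` to near-relaxed shifts (a matching datum `(t, A)` can always be re-chosen with
  relaxed `t`), which restores a margin ≈ 0.36 and roughly doubles the tolerable strain window.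
* VALIDATION of the Bloch code: `K(e)` against central finite differences of `s ↦ V(|e+sw|)`
  (rel. err 7e-7); `v*D(k)v` and `v*N(k)v` against second finite differences of the true LJ
  ENERGY of an 8×8×6 periodic supercell under `u_p = Re(v_m e^{ik·p})` at commensurate `k`, for
  the soft eigenvector and random `v`, ideal and worst datum: agreement to 5–6 digits
  (`crosscheck2.log`); relaxed-cell κ reproduces the two earlier refuters' independent codes.
* WHAT A PROOF NEEDS (for provers): Bloch/Plancherel reduction for finitely supported `u` on the
  two-lattice (`N(k) > 0` for `k ≠ 0`, kernel = translations at `k = 0`), interval arithmetic for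
  the 6×6 pencil on (BZ × window) with `r⁻⁸` tail enclosures, and the `k → 0` corner handled by the
  long-wave pencil — that is where the minimum sits; aim for `κ = 1/20` (half the numerical
  optimum), uniformly; do not expect more than `0.105`.
-/

/-- Admissible cells of radius `ρ` (the crux has `ρ = 1/40`). [folklore] -/
def AdmR (ρ : ℝ) (A : E3 →L[ℝ] E3) : Prop :=
  ∃ R : E3 ≃ₗᵢ[ℝ] E3, ‖A - (97 / 100 : ℝ) • (R.toContinuousLinearEquiv : E3 →L[ℝ] E3)‖ ≤ ρ

/-- Inner shifts of radius `ρ` (the crux has `ρ = 1/40`). [folklore] -/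
def InnerR (ρ : ℝ) (t : Fin 2 → E3) (A : E3 →L[ℝ] E3) : Prop :=
  ‖t 1 - t 0 - A (barlowOffset 1 + layerNormal (Real.sqrt (2 / 3)))‖ ≤ ρ

/-- The crux is the radius-`1/40` instance (definitional). [folklore] -/
theorem phononStability_iff_radius :
    PhononStability ↔ PhononStabilityOn fun t A => AdmR (1 / 40) A ∧ InnerR (1 / 40) t A :=
  phononStability_iff_on

/-- NEAR-MISS / natural strengthening, numerically FALSE, no Lean proof (workfile-only `sorry`):
the crux with radius `1/30` instead of `1/40` in both hypotheses fails — along the worst admissible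
datum of Part V scaled by `4/3` the long-wave generalized Bloch eigenvalue is ≈ `−0.04`
(`κ_lw(1.25) = −0.003`, `κ_lw(1.5) = −0.098`; `phonon/longwave_out.json` + blow-up table): the
prestressed acoustic tensor of the strained+shifted LJ hcp loses strong ellipticity.  Obstruction to
a Lean proof: certifying the SIGN of an infinite lattice-sum quadratic form with margin
`4e-2` against `r⁻⁸` tails and rounding needs the same interval-arithmetic machinery as the crux
itself (and a finitely supported enveloped-wave witness of ~5000 sites).  Tried: nothing formal;
recorded so that nobody files the `1/30` (or larger) window as a repair. [folklore] -/
theorem phononStability_false_at_radius_one_30th :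
    ¬ PhononStabilityOn fun t A => AdmR (1 / 30) A ∧ InnerR (1 / 30) t A := by
  sorry

end Summit.AtomisticToContinuum.Crystallization.Cruxes.PhononStability.Disproof

end
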